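import Summits.RiemannHypothesis.RiemannHypothesis.Theses.SpectralTrace
import Summits.RiemannHypothesis.RiemannHypothesis.Theorems.SpectralTraceSpectralThesisClosedLadderCells
import Summits.RiemannHypothesis.RiemannHypothesis.Theorems.SpectralTraceSpectralThesisBreakingWindow
import Literature.NumberTheory.LFunctions.WeilDilationVirial
import Literature.NumberTheory.LFunctions.WeilRescalingVariation
import Literature.NumberTheory.LFunctions.WeilMellinInversion
import HarnessLib

/-!
# Crux `SpectralThesis` (stmt-RiemannHypothesis-0187), line `Sketch` — the SAME-WINDOW theorem

The line `Sketch` runs the window ladder on OPEN windows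
(`Rung(A)`: a real family reproduces `W` on the Weil tests supported in `(-A, A)`), while the
route (`WindowTraceArch`, `WindowStep`, `WindowCompactness`) speaks of CLOSED windows
(`Trace(A)`: tests supported in `[-A, A]`). So far the two were only related with a loss
(`Rung(A + ε) → Trace(A) → Rung(A)`), which left one point undecided in the threshold normal form
of the residue (`SpectralTraceSpectralThesisBreakingWindow.lean`: under `¬ RH` the open rungs are
exactly `A ≤ A*`, the closed rungs hold for `A < A*` and fail for `A > A*`).

Main result (RH-free, hypothesis-free):

* `hasSum_Icc_of_Ioo_witness` : **a family reproducing `W` on the tests supported in the open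
  window `(-A, A)` reproduces it on every test supported in the closed window `[-A, A]`** — the
  SAME family, the SAME `A`. Proof: for a test `g` supported in `[-A, A]` the rescalings
  `g_c(t) = g(ct)`, `c > 1`, are supported in `(-A, A)`; `c ↦ W(g_c)` is continuous at `c = 1`
  (it is differentiable, `hasDerivAt_weilFunctional_comp_mul`); and
  `Σ_i ĝ_c(1/2+iγ_i) = Σ_i c⁻¹ ĝ(1/2 + iγ_i/c) → Σ_i ĝ(1/2+iγ_i)` by dominated convergence over the
  family, the domination `16 D_g/(1+γ_i²)²` being summable by the uniform local Weyl bound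
  (`exists_uniform_card_near_le_log`).

Consequences:

* `Icc_rung_iff_Ioo_rung` : `Trace(A) ↔ Rung(A)` for every `A > 0` — the route's and the line's
  rungs are interchangeable at the same window;
* `windowTraceArch_iff_Ioo_rung` : `WindowTraceArch ↔ Rung(log 2)`;
* `Icc_rung_iff_le_breakingWindow` : under a breaking window `A*` the CLOSED rungs are exactly
  `A ≤ A*` as well (the endpoint `A = A*`, left open by `not_Icc_rung_of_breakingWindow_lt` /
  `Icc_rung_of_lt_breakingWindow`, is decided: it holds);
* `natRung_iff_le_exp_breakingWindow`, `failing_step_eq_floor_exp_breakingWindow` : under a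
  breaking window the integer rungs `Trace(log n)` hold iff `n ≤ e^{A*}`, so the route's
  `WindowStep` fails at exactly ONE integer, `n = ⌊e^{A*}⌋`, and holds at every other `n ≥ 2`.
-/

noncomputable section

set_option linter.dupNamespace false

open Complex Set MeasureTheory Filter
open scoped Real Topology

namespace Summit.RiemannHypothesis.RiemannHypothesis.Theorems.SpectralThesis.Sketch

open Literature.NumberTheory.LFunctions
open Summit.RiemannHypothesis.RiemannHypothesis.Theses.SpectralTrace
open Summit.RiemannHypothesis.RiemannHypothesis.Theorems.SpectralThesis.Sketch.ClosedLadder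

namespace SameWindow

/-- Summability of the quartic cell weights over any window family: if `γ` reproduces `W` on the
Weil tests supported in `[-B, B]` (`B > 0`), then `Σ_i E / (1 + γ_i²)² < ∞` for every `E ≥ 0`
(cells `(n, n+1]` carry `≤ C (2 + |n|)` points by the uniform local Weyl bound, and
`1 + n² ≤ 4 (1 + γ_i²)` on the cell). [folklore] -/
theorem summable_quartic_of_window {B : ℝ} (hB : 0 < B) {ι : Type} {γ : ι → ℝ}
    (hγ : ∀ g : ℝ → ℂ, IsWeilTest g → tsupport g ⊆ Icc (-B) B →
      HasSum (fun i => weilMellin g (1 / 2 + (γ i : ℂ) * I)) (weilFunctional g))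
    {E : ℝ} (hE : 0 ≤ E) :
    Summable fun i : ι => E / (1 + (γ i) ^ 2) ^ 2 := by
  obtain ⟨C, hC, hcount⟩ := exists_uniform_card_near_le_log hB
  -- cells `cls i = n ↔ γ_i ∈ (n, n+1]`
  set cls : ι → ℤ := fun i => ⌈γ i⌉ - 1 with hcls_def
  have hcls : ∀ i, γ i ∈ Ioc ((cls i : ℝ)) ((cls i : ℝ) + 1) := fun i => by
    simp only [hcls_def]
    push_cast
    exact ⟨by linarith [Int.ceil_lt_add_one (γ i)], by linarith [Int.le_ceil (γ i)]⟩
  -- finiteness and the uniform bound of the cell counts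
  have hκ : ∀ n : ℤ, Finite {i // cls i = n} ∧
      (Nat.card {i // cls i = n} : ℝ) ≤ C * (2 + |(n : ℝ)|) := by
    intro n
    refine finite_and_natCard_le fun t ht => ?_
    have h1 := hcount γ hγ ((n : ℝ) + 1 / 2) t fun i hi => ?_
    · refine h1.trans (mul_le_mul_of_nonneg_left ?_ hC.le)
      have h2 : Real.log (1 + |(n : ℝ) + 1 / 2|) ≤ |(n : ℝ) + 1 / 2| := by
        have := Real.log_le_sub_one_of_pos (by positivity : (0 : ℝ) < 1 + |(n : ℝ) + 1 / 2|)
        linarith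
      have h3 : |(n : ℝ) + 1 / 2| ≤ |(n : ℝ)| + 1 / 2 := by
        have := abs_add_le (n : ℝ) (1 / 2)
        rwa [abs_of_pos (by norm_num : (0 : ℝ) < 1 / 2)] at this
      linarith
    · have hm := hcls i
      rw [ht i hi] at hm
      rw [abs_le]
      constructor <;> linarith [hm.1, hm.2]
  -- the cell weight and its bound on a cell
  set φ : ℤ → ℝ := fun n => 16 * E / (1 + (n : ℝ) ^ 2) ^ 2 with hφ_def
  have hφ0 : ∀ n, 0 ≤ φ n := fun n => by positivity
  have hcell : ∀ i, E / (1 + (γ i) ^ 2) ^ 2 ≤ φ (cls i) := by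
    intro i
    have hm := hcls i
    set u : ℝ := γ i
    set n : ℤ := cls i
    have h0 : (u - n) ^ 2 ≤ 1 := by nlinarith [hm.1, hm.2]
    have h4 : 1 + (n : ℝ) ^ 2 ≤ 4 * (1 + u ^ 2) := by nlinarith [sq_nonneg (u + (u - n))]
    have h5 : (0 : ℝ) < 1 + (n : ℝ) ^ 2 := by positivity
    have h1 : (1 + (n : ℝ) ^ 2) ^ 2 ≤ 16 * (1 + u ^ 2) ^ 2 := by nlinarith
    simp only [hφ_def]
    rw [div_le_div_iff₀ (by positivity) (by positivity)]
    calc E * (1 + (n : ℝ) ^ 2) ^ 2 ≤ E * (16 * (1 + u ^ 2) ^ 2) :=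
          mul_le_mul_of_nonneg_left h1 hE
      _ = 16 * E * (1 + u ^ 2) ^ 2 := by ring
  -- summation over the sigma type of cells
  have hb : Summable fun n : ℤ => C * (2 + |(n : ℝ)|) * φ n := summable_cellBound C E hE
  have hnn : ∀ i, 0 ≤ E / (1 + (γ i) ^ 2) ^ 2 := fun i => by positivity
  rw [← (Equiv.sigmaFiberEquiv cls).summable_iff]
  refine (summable_sigma_of_nonneg fun p => hnn _).2 ⟨fun n => ?_, ?_⟩
  · haveI : Finite {i // cls i = n} := (hκ n).1
    exact Summable.of_finite
  · refine Summable.of_nonneg_of_le (fun n => tsum_nonneg fun _ => hnn _) (fun n => ?_) hb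
    haveI : Finite {i // cls i = n} := (hκ n).1
    haveI : Fintype {i // cls i = n} := Fintype.ofFinite _
    rw [tsum_fintype]
    calc ∑ p : {i // cls i = n}, E / (1 + (γ ((Equiv.sigmaFiberEquiv cls) ⟨n, p⟩)) ^ 2) ^ 2
        ≤ ∑ _p : {i // cls i = n}, φ n := Finset.sum_le_sum fun p _ => by
          have h := hcell p.1
          have hp : cls p.1 = n := p.2
          rw [hp] at h
          simpa only [Equiv.sigmaFiberEquiv_apply] using h
      _ = (Nat.card {i // cls i = n} : ℝ) * φ n := by
          rw [Finset.sum_const, nsmul_eq_mul, Finset.card_univ, Nat.card_eq_fintype_card]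
      _ ≤ C * (2 + |(n : ℝ)|) * φ n := mul_le_mul_of_nonneg_right (hκ n).2 (hφ0 n)

/-- The rescaled transform on the critical line: `(g(c ·))^(1/2 + iu) = c⁻¹ ĝ(1/2 + iu/c)`
(`c > 0`). [folklore] -/
theorem weilMellin_comp_mul_line (g : ℝ → ℂ) {c : ℝ} (hc : 0 < c) (u : ℝ) :
    weilMellin (fun t => g (c * t)) (1 / 2 + (u : ℂ) * I) =
      (c : ℂ)⁻¹ * weilMellin g (1 / 2 + ((u / c : ℝ) : ℂ) * I) := by
  rw [weilMellin_comp_mul g hc]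
  congr 2
  have hc' : (c : ℂ) ≠ 0 := Complex.ofReal_ne_zero.2 hc.ne'
  push_cast
  field_simp
  ring

/-- Domination of the rescaled transforms, uniformly for `1 ≤ c ≤ 2`:
`‖c⁻¹ ĝ(1/2 + iu/c)‖ ≤ 16 D_g / (1 + u²)²`, `D_g = C_g + C_{g''}`. [folklore] -/
theorem norm_rescaled_weilMellin_le {g : ℝ → ℂ} (hg : IsWeilTest g) {c : ℝ} (hc1 : 1 ≤ c)
    (hc2 : c ≤ 2) (u : ℝ) :
    ‖(c : ℂ)⁻¹ * weilMellin g (1 / 2 + ((u / c : ℝ) : ℂ) * I)‖ ≤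
      16 * (weilDecayConst g + weilDecayConst (deriv (deriv g))) / (1 + u ^ 2) ^ 2 := by
  set D : ℝ := weilDecayConst g + weilDecayConst (deriv (deriv g)) with hD_def
  have hD0 : 0 ≤ D := add_nonneg (weilDecayConst_nonneg _) (weilDecayConst_nonneg _)
  have hc0 : 0 < c := by linarith
  have h1 : ‖weilMellin g (1 / 2 + ((u / c : ℝ) : ℂ) * I)‖ ≤ D / (1 + (u / c) ^ 2) ^ 2 :=
    norm_weilMellin_line_le_sq hg (u / c)
  have hn0 : 0 ≤ ‖weilMellin g (1 / 2 + ((u / c : ℝ) : ℂ) * I)‖ := norm_nonneg _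
  rw [norm_mul, norm_inv, Complex.norm_real, Real.norm_of_nonneg hc0.le]
  have hinv : c⁻¹ ≤ 1 := inv_le_one_of_one_le₀ hc1
  have h2 : c⁻¹ * ‖weilMellin g (1 / 2 + ((u / c : ℝ) : ℂ) * I)‖ ≤ D / (1 + (u / c) ^ 2) ^ 2 :=
    calc c⁻¹ * ‖weilMellin g (1 / 2 + ((u / c : ℝ) : ℂ) * I)‖
        ≤ 1 * ‖weilMellin g (1 / 2 + ((u / c : ℝ) : ℂ) * I)‖ :=
          mul_le_mul_of_nonneg_right hinv hn0
      _ ≤ D / (1 + (u / c) ^ 2) ^ 2 := by rw [one_mul]; exact h1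
  refine h2.trans ?_
  have hq : 0 < 1 + (u / c) ^ 2 := by positivity
  rw [div_le_div_iff₀ (by positivity) (by positivity)]
  -- `1 + u² ≤ 4 (1 + (u/c)²)` since `c ≤ 2`
  have huc : u ^ 2 ≤ 4 * (u / c) ^ 2 := by
    rw [div_pow]
    rw [mul_div_assoc', le_div_iff₀ (by positivity)]
    have : c ^ 2 ≤ 4 := by nlinarith
    nlinarith [sq_nonneg u]
  have h4 : 1 + u ^ 2 ≤ 4 * (1 + (u / c) ^ 2) := by linarith
  have h5 : (1 + u ^ 2) ^ 2 ≤ 16 * (1 + (u / c) ^ 2) ^ 2 := by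
    have h6 : 0 ≤ 1 + u ^ 2 := by positivity
    nlinarith
  calc D * (1 + u ^ 2) ^ 2 ≤ D * (16 * (1 + (u / c) ^ 2) ^ 2) := mul_le_mul_of_nonneg_left h5 hD0
    _ = 16 * D * (1 + (u / c) ^ 2) ^ 2 := by ring

end SameWindow

open SameWindow

/-- **Same-window theorem.** A real family `γ` reproducing the Weil functional on the Weil tests
supported in the OPEN window `(-A, A)` (`A > 0`) reproduces it on every Weil test supported in the
CLOSED window `[-A, A]`: `HasSum (i ↦ ĝ(1/2 + iγ_i)) (W g)`. Proof: the rescalings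
`g_c = g(c ·)`, `c > 1`, are supported in `(-A, A)`; `W(g_c) → W(g)` as `c → 1`
(`hasDerivAt_weilFunctional_comp_mul`); `Σ_i ĝ_c(1/2+iγ_i) = Σ_i c⁻¹ ĝ(1/2+iγ_i/c) → Σ_i ĝ(1/2+iγ_i)`
by dominated convergence (`summable_quartic_of_window`, `norm_rescaled_weilMellin_le`).
[folklore] -/
theorem hasSum_Icc_of_Ioo_witness {A : ℝ} (hA : 0 < A) {ι : Type} {γ : ι → ℝ}
    (hγ : ∀ g : ℝ → ℂ, IsWeilTest g → tsupport g ⊆ Ioo (-A) A →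
      HasSum (fun i => weilMellin g (1 / 2 + (γ i : ℂ) * I)) (weilFunctional g))
    {g : ℝ → ℂ} (hg : IsWeilTest g) (hgs : tsupport g ⊆ Icc (-A) A) :
    HasSum (fun i => weilMellin g (1 / 2 + (γ i : ℂ) * I)) (weilFunctional g) := by
  set F : ℝ → ℂ := fun u => weilMellin g (1 / 2 + (u : ℂ) * I) with hF_def
  set D : ℝ := weilDecayConst g + weilDecayConst (deriv (deriv g)) with hD_def
  have hD0 : 0 ≤ D := add_nonneg (weilDecayConst_nonneg _) (weilDecayConst_nonneg _)
  -- the family is a closed-window family on `[-A/2, A/2]`, hence the quartic weights are summable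
  have hB : 0 < A / 2 := half_pos hA
  have hγB : ∀ k : ℝ → ℂ, IsWeilTest k → tsupport k ⊆ Icc (-(A / 2)) (A / 2) →
      HasSum (fun i => weilMellin k (1 / 2 + (γ i : ℂ) * I)) (weilFunctional k) :=
    fun k hk hks => hγ k hk (hks.trans (Icc_subset_Ioo (by linarith) (by linarith)))
  set bound : ι → ℝ := fun i => 16 * D / (1 + (γ i) ^ 2) ^ 2 with hbound_def
  have hbound : Summable bound := summable_quartic_of_window hB hγB (by positivity : 0 ≤ 16 * D)
  -- the rescaled tests
  have htest : ∀ c : ℝ, 0 < c → IsWeilTest (fun t => g (c * t)) := fun c hc => hg.comp_mul hc.ne'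
  have hsupp : ∀ c : ℝ, 1 < c → tsupport (fun t => g (c * t)) ⊆ Ioo (-A) A := by
    intro c hc
    have hc0 : 0 < c := by linarith
    have hlt : A / c < A := by
      rw [div_lt_iff₀ hc0]
      nlinarith
    exact (tsupport_comp_mul_subset g hc0 hgs).trans (Icc_subset_Ioo (by linarith) hlt)
  -- the rescaled sums, termwise
  set f : ℝ → ι → ℂ := fun c i => (c : ℂ)⁻¹ * F (γ i / c) with hf_def
  have hf_eq : ∀ c : ℝ, 0 < c → ∀ i,
      weilMellin (fun t => g (c * t)) (1 / 2 + (γ i : ℂ) * I) = f c i :=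
    fun c hc i => weilMellin_comp_mul_line g hc (γ i)
  -- (i) for `c > 1` the rescaled sum IS `W(g_c)`
  have hsum_c : ∀ c : ℝ, 1 < c → HasSum (f c) (weilFunctional (fun t => g (c * t))) := by
    intro c hc
    have h := hγ _ (htest c (by linarith)) (hsupp c hc)
    simpa only [hf_eq c (by linarith)] using h
  -- (ii) domination for `c ∈ [1, 2]`
  have hdom : ∀ᶠ c in 𝓝[>] (1 : ℝ), ∀ i, ‖f c i‖ ≤ bound i := by
    have hmem : Ioo (1 : ℝ) 2 ∈ 𝓝[>] (1 : ℝ) := Ioo_mem_nhdsGT (by norm_num)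
    filter_upwards [hmem] with c hc i
    exact norm_rescaled_weilMellin_le hg hc.1.le hc.2.le (γ i)
  -- (iii) termwise convergence `f c i → F(γ_i)` as `c → 1`
  have hFc : Continuous F := (continuous_weilMellin hg.1.continuous hg.2).comp (by fun_prop)
  have hlim : ∀ i, Tendsto (fun c => f c i) (𝓝[>] (1 : ℝ)) (𝓝 (F (γ i))) := by
    intro i
    have h1 : ContinuousAt (fun c : ℝ => (c : ℂ)⁻¹ * F (γ i / c)) 1 := by
      refine ContinuousAt.mul ?_ ?_
      · exact (Complex.continuous_ofReal.continuousAt).inv₀ (by norm_num)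
      · exact hFc.continuousAt.comp (continuousAt_const.div continuousAt_id (by norm_num))
    have h2 : (fun c : ℝ => (c : ℂ)⁻¹ * F (γ i / c)) 1 = F (γ i) := by simp
    rw [← h2]
    exact (h1.tendsto).mono_left nhdsWithin_le_nhds
  -- (iv) dominated convergence over the family
  have hT : Tendsto (fun c => ∑' i, f c i) (𝓝[>] (1 : ℝ)) (𝓝 (∑' i, F (γ i))) :=
    tendsto_tsum_of_dominated_convergence hbound hlim hdom
  -- (v) continuity of `c ↦ W(g_c)` at `c = 1`
  have hW : Tendsto (fun c : ℝ => weilFunctional (fun t => g (c * t))) (𝓝[>] (1 : ℝ))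
      (𝓝 (weilFunctional g)) := by
    have h1 := (hasDerivAt_weilFunctional_comp_mul hg one_pos).continuousAt.tendsto
    have h2 : (fun t : ℝ => g (1 * t)) = g := funext fun t => by rw [one_mul]
    rw [h2] at h1
    exact h1.mono_left nhdsWithin_le_nhds
  -- (vi) the two limits agree
  have heq : ∑' i, F (γ i) = weilFunctional g := by
    refine tendsto_nhds_unique hT (hW.congr' ?_)
    have hmem : Ioi (1 : ℝ) ∈ 𝓝[>] (1 : ℝ) := self_mem_nhdsWithin
    filter_upwards [hmem] with c hc
    exact ((hsum_c c hc).tsum_eq).symm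
  -- (vii) absolute convergence at `c = 1` and the conclusion
  have hsumF : Summable fun i => F (γ i) := by
    refine Summable.of_norm_bounded hbound fun i => ?_
    have h := norm_rescaled_weilMellin_le hg le_rfl one_le_two (γ i)
    rwa [div_one, Complex.ofReal_one, inv_one, one_mul] at h
  rw [← heq]
  exact hsumF.hasSum

/-- **`Trace(A) ↔ Rung(A)` at the same window** (`A > 0`): a real family for the Weil tests
supported in `[-A, A]` exists iff one exists for the tests supported in `(-A, A)` (and then the
same family serves both). [folklore] -/
theorem Icc_rung_iff_Ioo_rung {A : ℝ} (hA : 0 < A) :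
    (∃ (ι : Type) (γ : ι → ℝ), ∀ g : ℝ → ℂ, IsWeilTest g → tsupport g ⊆ Icc (-A) A →
      HasSum (fun i => weilMellin g (1 / 2 + (γ i : ℂ) * I)) (weilFunctional g)) ↔
    (∃ (ι : Type) (γ : ι → ℝ), ∀ g : ℝ → ℂ, IsWeilTest g → tsupport g ⊆ Ioo (-A) A →
      HasSum (fun i => weilMellin g (1 / 2 + (γ i : ℂ) * I)) (weilFunctional g)) := by
  constructor
  · rintro ⟨ι, γ, hγ⟩
    exact ⟨ι, γ, fun g hg hgs => hγ g hg (hgs.trans Ioo_subset_Icc_self)⟩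
  · rintro ⟨ι, γ, hγ⟩
    exact ⟨ι, γ, fun g hg hgs => hasSum_Icc_of_Ioo_witness hA hγ hg hgs⟩

/-- **The seed item in the line's language**: `WindowTraceArch ↔ Rung(log 2)` (the archimedean
closed-window rung of stmt-RiemannHypothesis-11195 is the open-window rung at `log 2`).
[folklore] -/
theorem windowTraceArch_iff_Ioo_rung :
    WindowTraceArch ↔
      ∃ (ι : Type) (γ : ι → ℝ), ∀ g : ℝ → ℂ, IsWeilTest g →
        tsupport g ⊆ Ioo (-Real.log 2) (Real.log 2) →
          HasSum (fun i => weilMellin g (1 / 2 + (γ i : ℂ) * I)) (weilFunctional g) :=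
  Icc_rung_iff_Ioo_rung (Real.log_pos one_lt_two)

/-! ## The breaking window in the closed-window language, endpoint included -/

/-- **Closed rungs under a breaking window are exactly `A ≤ A*`.** If the open rungs are exactly
the windows `A ≤ A*` (the breaking window of `stub_breakingWindow` under `¬ RH`), then so are the
closed rungs `Trace(A)`, `A > 0` — including the endpoint `A = A*`, where the closed rung HOLDS
(`hasSum_Icc_of_Ioo_witness`). [folklore] -/
theorem Icc_rung_iff_le_breakingWindow {Astar : ℝ}
    (h : ∀ A : ℝ, 0 < A →
      ((∃ (ι : Type) (γ : ι → ℝ), ∀ g : ℝ → ℂ, IsWeilTest g → tsupport g ⊆ Set.Ioo (-A) A →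
        HasSum (fun i => weilMellin g (1 / 2 + (γ i : ℂ) * I)) (weilFunctional g)) ↔ A ≤ Astar))
    {A : ℝ} (hA : 0 < A) :
    (∃ (ι : Type) (γ : ι → ℝ), ∀ g : ℝ → ℂ, IsWeilTest g → tsupport g ⊆ Set.Icc (-A) A →
      HasSum (fun i => weilMellin g (1 / 2 + (γ i : ℂ) * I)) (weilFunctional g)) ↔ A ≤ Astar :=
  (Icc_rung_iff_Ioo_rung hA).trans (h A hA)

/-- **The closed rung AT the breaking window holds** (the endpoint left open by
`Icc_rung_of_lt_breakingWindow` / `not_Icc_rung_of_breakingWindow_lt`). [folklore] -/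
theorem Icc_rung_at_breakingWindow {Astar : ℝ} (h0 : 0 < Astar)
    (h : ∀ A : ℝ, 0 < A →
      ((∃ (ι : Type) (γ : ι → ℝ), ∀ g : ℝ → ℂ, IsWeilTest g → tsupport g ⊆ Set.Ioo (-A) A →
        HasSum (fun i => weilMellin g (1 / 2 + (γ i : ℂ) * I)) (weilFunctional g)) ↔ A ≤ Astar)) :
    ∃ (ι : Type) (γ : ι → ℝ), ∀ g : ℝ → ℂ, IsWeilTest g → tsupport g ⊆ Set.Icc (-Astar) Astar →
      HasSum (fun i => weilMellin g (1 / 2 + (γ i : ℂ) * I)) (weilFunctional g) :=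
  (Icc_rung_iff_le_breakingWindow h h0).2 le_rfl

/-- **Integer rungs under a breaking window**: for `n ≥ 1`, the route's rung `Trace(log n)` holds
iff `n ≤ e^{A*}`. [folklore] -/
theorem natRung_iff_le_exp_breakingWindow {Astar : ℝ}
    (h : ∀ A : ℝ, 0 < A →
      ((∃ (ι : Type) (γ : ι → ℝ), ∀ g : ℝ → ℂ, IsWeilTest g → tsupport g ⊆ Set.Ioo (-A) A →
        HasSum (fun i => weilMellin g (1 / 2 + (γ i : ℂ) * I)) (weilFunctional g)) ↔ A ≤ Astar))
    {n : ℕ} (hn : 2 ≤ n) :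
    (∃ (ι : Type) (γ : ι → ℝ), ∀ g : ℝ → ℂ, IsWeilTest g →
      tsupport g ⊆ Set.Icc (-Real.log (n : ℝ)) (Real.log (n : ℝ)) →
        HasSum (fun i => weilMellin g (1 / 2 + (γ i : ℂ) * I)) (weilFunctional g)) ↔
      (n : ℝ) ≤ Real.exp Astar := by
  have hn1 : (1 : ℝ) < n := by exact_mod_cast hn
  have hlog : 0 < Real.log (n : ℝ) := Real.log_pos hn1
  rw [Icc_rung_iff_le_breakingWindow h hlog, Real.log_le_iff_le_exp (by linarith)]

/-- **The failing step is exactly `n = ⌊e^{A*}⌋`.** Under a breaking window `A*`, for `n ≥ 2`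
the integer step `Trace(log n) → Trace(log (n+1))` of the route's `WindowStep` FAILS (rung at
`log n`, none at `log (n+1)`) iff `n = ⌊e^{A*}⌋`; so it fails at exactly one integer when
`2 ≤ e^{A*}` (e.g. given `WindowTraceArch`, `log_two_le_breakingWindow_of_windowTraceArch`) and at
none otherwise (then already `Trace(log 2)` fails). [folklore] -/
theorem failing_step_eq_floor_exp_breakingWindow {Astar : ℝ}
    (h : ∀ A : ℝ, 0 < A →
      ((∃ (ι : Type) (γ : ι → ℝ), ∀ g : ℝ → ℂ, IsWeilTest g → tsupport g ⊆ Set.Ioo (-A) A →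
        HasSum (fun i => weilMellin g (1 / 2 + (γ i : ℂ) * I)) (weilFunctional g)) ↔ A ≤ Astar))
    {n : ℕ} (hn : 2 ≤ n) :
    ((∃ (ι : Type) (γ : ι → ℝ), ∀ g : ℝ → ℂ, IsWeilTest g →
        tsupport g ⊆ Set.Icc (-Real.log (n : ℝ)) (Real.log (n : ℝ)) →
          HasSum (fun i => weilMellin g (1 / 2 + (γ i : ℂ) * I)) (weilFunctional g)) ∧
      ¬ ∃ (ι : Type) (γ : ι → ℝ), ∀ g : ℝ → ℂ, IsWeilTest g →
        tsupport g ⊆ Set.Icc (-Real.log ((n : ℝ) + 1)) (Real.log ((n : ℝ) + 1)) →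
          HasSum (fun i => weilMellin g (1 / 2 + (γ i : ℂ) * I)) (weilFunctional g)) ↔
      n = ⌊Real.exp Astar⌋₊ := by
  have hn' : 2 ≤ n + 1 := by omega
  have hcast : ((n + 1 : ℕ) : ℝ) = (n : ℝ) + 1 := by push_cast; ring
  have hstep := natRung_iff_le_exp_breakingWindow h hn'
  rw [hcast] at hstep
  rw [natRung_iff_le_exp_breakingWindow h hn, hstep, not_le]
  have hexp0 : 0 ≤ Real.exp Astar := (Real.exp_pos _).le
  constructor
  · rintro ⟨hle, hlt⟩
    exact ((Nat.floor_eq_iff hexp0).2 ⟨hle, hlt⟩).symm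
  · intro heq
    exact (Nat.floor_eq_iff hexp0).1 heq.symm

/-! ## Landing anchor -/

/-- **Landing anchor of this file** (registered stub `stub_sameWindow` of item
stmt-RiemannHypothesis-0187, line `Sketch`): binder-free restatement of the same-window theorem
`hasSum_Icc_of_Ioo_witness`. [folklore] -/
theorem stub_sameWindow : ∀ {A : ℝ}, 0 < A → ∀ {ι : Type} (γ : ι → ℝ),
    (∀ g : ℝ → ℂ, IsWeilTest g → tsupport g ⊆ Set.Ioo (-A) A →
      HasSum (fun i => weilMellin g (1 / 2 + (γ i : ℂ) * I)) (weilFunctional g)) →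
    ∀ g : ℝ → ℂ, IsWeilTest g → tsupport g ⊆ Set.Icc (-A) A →
      HasSum (fun i => weilMellin g (1 / 2 + (γ i : ℂ) * I)) (weilFunctional g) := by
  intro A hA ι γ hγ g hg hgs
  exact hasSum_Icc_of_Ioo_witness hA hγ hg hgs

end Summit.RiemannHypothesis.RiemannHypothesis.Theorems.SpectralThesis.Sketch

end
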